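import Summits.QuantumFields.YangMills.Theorems.BalabanUVNodesN15DerivDefect
import Literature.MathematicalPhysics.QuantumFieldTheory.King1986.TorusBlockForm

/-!
# Route «BalabanUVNodes» (K4 «SpineRates»), node N15 = NE2, BACKGROUND LAYER — THE DICTIONARY TO KING'S TORUS CARRIER: block-line data on
# `Tor (fine L M) → Tor M` along `King1986.Torus.blockOf` (sites `y = L·b + j`), direction by direction, and the block sum as the fibre sum

Cell `pub-ymgap`, seat `pub-ymgap-dag-n15-b` (D-0062; `bears_on: R4∕N15`; `--supports stmt-QuantumFields-19351 --as helper`).  Imports this seat's part 1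
`…N15.DerivDefect` (p409078 ✓: `LineData`, `fdiffN`, `idef_fdiffN_apply`) and the tree's `King1986.TorusBlockForm` (cell `pub-balaban` template file:
`Torus.site L M b j`, `Torus.blockEquiv`, `Torus.blockOf`, `Torus.blockSum`) BY NAME; nothing landed is modified.

THE POINT (HANDOFF-dag-n15-b §6(ii); asked for by dag-n15-a g2 [DAGN15A-G2-INTENT-1]: *«I state the torus formula on `King1986.TorusBlockForm`'s carrier
`blockOf L M : Tor (fine L M) → Tor M` where b05's `B5Block118.bpt`∕King's minimiser live, so your transport meets it there»*).  Parts 1–3 of this seat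
state the η-defect of the lattice derivative over ABSTRACT block-line data and inhabit it on `ℤ^d`, on the circle and on the product torus
`(ZMod n × Fin M)^d`.  The tree's torus-kernel theorems (b04∕b05 lineages, King's template, the -a knit `NE2NodeTorus`) live on the MULTI-PERIOD torus
`B5Prop11Plancherel.Tor N = Π_μ ℤ∕N_μ` with the fine torus `Tor (fine L M)`, `fine L M μ = L·M_μ`, blocked by `King1986.Torus.blockOf L M` through the
parametrisation `blockEquiv L M : Tor M × [0,L)^d ≃ Tor (fine L M)`, `(b, j) ↦ site L M b j = L·b + j`.  THIS FILE builds, for every direction `μ`,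
the block-line data of THAT pairing (`kingLine L M μ : LineData (Tor M) (Tor (fine L M))`: spacing ratio `L`, `π = blockOf L M`, coarse shift `b ↦ b + e_μ`,
fine shift the genuine torus translation `y ↦ y + e_μ`, depth = the μ-th in-block offset `j_μ`), proving the four bookkeeping axioms by the site
arithmetic `(L·b + j) + e_μ = L·b + (j + e_μ)` below the face and `= L·(b + e_μ) + (j with j_μ = 0)` on it (with the wrap-around `L·M_μ ≡ 0`), so that
EVERY theorem of parts 1–2 and 4 (`idef_fdiffN_eq`, `bdiff_comp_stair`, `hasMaj_comp_idef_fdiffN_comp`, `hasMaj_comp_idef_firstOrder_comp`, …) applies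
on King's carrier BY NAME (`idef_fdiffN_king_apply`).  (The fibre sums of this pairing — `Σ_{z′ ∈ fibre blockOf b} f z′ = Σ_j f(L·b + j)` — and the
translation-invariant defect kernel on these tori are dag-n15-a g2's `…N15.DefectKernel.sum_fibre_blockOf` ∕ `idef_entry_transl` (p411666), not
restated here.)

THE PRINT (convention only).  King, CMP 102 (1986) p. 664: *«When x′ ∈ T_{η′}, we denote by x that point in T_η for which x′ ∈ B^n(x)»* — here
`x = blockOf L M x′`; [Balaban1984PropagatorsI] (1.18) p. 21 (the blocks `B(y)` of `L^d` sites, tree `B5Block118`).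

HONEST FRAMING ∕ LIMITS.  [folklore] plumbing (one def + site arithmetic); nothing about any operator asserted.  NE2⁺ NOT PRINTED, NOT proved; count-neutral
(typed 28∕28 · discharged 0∕28); finite tori; nothing continuum ∕ ℝ⁴ ∕ OS ∕ mass-gap ∕ Clay.
-/

noncomputable section

namespace Summit.QuantumFields.YangMills.BalabanUVNodes.N15.KingTorusLine

open Literature.MathematicalPhysics.QuantumFieldTheory.Balaban1983to89
open Literature.MathematicalPhysics.QuantumFieldTheory.Balaban1983to89.B5Prop11Plancherel (Tor fine)
open Literature.MathematicalPhysics.QuantumFieldTheory.King1986.Torus (site blockEquiv blockEquiv_apply blockOf blockOf_site val_site)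
open Summit.QuantumFields.YangMills.BalabanUVNodes.N15.DerivDefect

variable {d : ℕ} (L : ℕ) [NeZero L] (M : Fin d → ℕ) [hM : ∀ μ, NeZero (M μ)] (μ : Fin d)

/-! ## §1 Site arithmetic: one step in direction `μ` inside a block and across its face -/

/-- The unit vector `e_μ` of a multi-period torus. [folklore] -/
def unitVec (N : Fin d → ℕ) (μ : Fin d) : Tor N := Pi.single μ 1

/-- Off the direction `μ` the unit vector vanishes. [folklore] -/
theorem unitVec_of_ne (N : Fin d → ℕ) {μ ν : Fin d} (h : ν ≠ μ) : unitVec N μ ν = 0 := by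
  simp [unitVec, Pi.single_eq_of_ne h]

/-- In the direction `μ` the unit vector is `1`. [folklore] -/
theorem unitVec_same (N : Fin d → ℕ) (μ : Fin d) : unitVec N μ μ = 1 := by
  simp [unitVec]

/-- `L·((v + 1) mod M) ≡ L·(v + 1) (mod L·M)`: the wrap-around of the coarse coordinate is invisible on the fine torus. [folklore] -/
theorem cast_mul_succ_mod (Lr Mr v : ℕ) :
    ((Lr * ((v + 1) % Mr) : ℕ) : ZMod (Lr * Mr)) = ((Lr * (v + 1) : ℕ) : ZMod (Lr * Mr)) := by
  rw [ZMod.natCast_eq_natCast_iff']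
  rw [Nat.mul_mod_mul_left, Nat.mul_mod_mul_left, Nat.mod_mod]

omit [NeZero L] hM in
/-- BELOW THE FACE: `(L·b + j) + e_μ = L·b + (j + e_μ)` when `j_μ + 1 < L`. [folklore] -/
theorem site_add_unitVec_of_lt (b : Tor M) (j : Fin d → Fin L) (h : (j μ : ℕ) + 1 < L) :
    site L M b j + unitVec (fine L M) μ = site L M b (Function.update j μ ⟨(j μ : ℕ) + 1, h⟩) := by
  funext ν
  by_cases hν : ν = μ
  · subst hν
    rw [Pi.add_apply, unitVec_same]
    show ((L * (b ν).val + (j ν : ℕ) : ℕ) : ZMod (fine L M ν)) + 1 =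
      ((L * (b ν).val + ((Function.update j ν ⟨(j ν : ℕ) + 1, h⟩ ν : Fin L) : ℕ) : ℕ) : ZMod (fine L M ν))
    rw [Function.update_self]
    push_cast
    ring
  · rw [Pi.add_apply, unitVec_of_ne _ hν, add_zero]
    show ((L * (b ν).val + (j ν : ℕ) : ℕ) : ZMod (fine L M ν)) =
      ((L * (b ν).val + ((Function.update j μ ⟨(j μ : ℕ) + 1, h⟩ ν : Fin L) : ℕ) : ℕ) : ZMod (fine L M ν))
    rw [Function.update_of_ne hν]

/-- ON THE FACE: `(L·b + j) + e_μ = L·(b + e_μ) + (j with j_μ := 0)` when `j_μ + 1 = L` (the coarse coordinate wraps with the fine one: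
`L·M_μ ≡ 0`). [folklore] -/
theorem site_add_unitVec_of_eq (b : Tor M) (j : Fin d → Fin L) (h : (j μ : ℕ) + 1 = L) :
    site L M b j + unitVec (fine L M) μ =
      site L M (b + unitVec M μ) (Function.update j μ ⟨0, Nat.pos_of_ne_zero (NeZero.ne L)⟩) := by
  funext ν
  by_cases hν : ν = μ
  · subst hν
    rw [Pi.add_apply, unitVec_same]
    show ((L * (b ν).val + (j ν : ℕ) : ℕ) : ZMod (fine L M ν)) + 1 =
      ((L * ((b + unitVec M ν) ν).val + ((Function.update j ν ⟨0, _⟩ ν : Fin L) : ℕ) : ℕ) : ZMod (fine L M ν))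
    rw [Function.update_self, Pi.add_apply, unitVec_same, ZMod.val_add, ZMod.val_one_eq_one_mod, Nat.add_mod_mod]
    show ((L * (b ν).val + (j ν : ℕ) : ℕ) : ZMod (L * M ν)) + 1 = ((L * (((b ν).val + 1) % M ν) + (0 : ℕ) : ℕ) : ZMod (L * M ν))
    rw [add_zero, cast_mul_succ_mod]
    have hj : L * (b ν).val + (j ν : ℕ) + 1 = L * ((b ν).val + 1) := by
      rw [mul_add, mul_one, add_assoc, h]
    rw [← Nat.cast_add_one, hj]
  · rw [Pi.add_apply, unitVec_of_ne _ hν, add_zero]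
    show ((L * (b ν).val + (j ν : ℕ) : ℕ) : ZMod (fine L M ν)) =
      ((L * ((b + unitVec M μ) ν).val + ((Function.update j μ ⟨0, _⟩ ν : Fin L) : ℕ) : ℕ) : ZMod (fine L M ν))
    rw [Function.update_of_ne hν, Pi.add_apply, unitVec_of_ne _ hν, add_zero]

/-- The inverse parametrisation at a site: `blockEquiv⁻¹(L·b + j) = (b, j)`. [folklore] -/
theorem blockEquiv_symm_site (b : Tor M) (j : Fin d → Fin L) : (blockEquiv L M).symm (site L M b j) = (b, j) := by
  rw [← blockEquiv_apply, Equiv.symm_apply_apply]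

/-! ## §2 The block-line data of King's pairing in direction `μ` -/

/-- **KING'S PAIRING AS BLOCK-LINE DATA**, direction `μ`: coarse torus `Tor M`, fine torus `Tor (fine L M)` (`fine L M μ = L·M_μ`), spacing ratio `L`,
block projection `π = blockOf L M` (`⌊y∕L⌋`), coarse shift `b ↦ b + e_μ`, fine shift the torus translation `y ↦ y + e_μ`, depth = the μ-th in-block
offset `j_μ` of `y = L·b + j`. [cite: King1986, p.664 (pairing convention «x′ ∈ B^n(x)»)] -/
def kingLine : LineData (Tor M) (Tor (fine L M)) where
  M := L
  M_pos := Nat.pos_of_ne_zero (NeZero.ne L)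
  π := blockOf L M
  s := fun b => b + unitVec M μ
  s' := Equiv.addRight (unitVec (fine L M) μ)
  dep := fun y => (((blockEquiv L M).symm y).2 μ : ℕ)
  dep_lt := fun y => (((blockEquiv L M).symm y).2 μ).isLt
  π_succ_of_lt := fun y h => by
    obtain ⟨⟨b, j⟩, rfl⟩ := (blockEquiv L M).surjective y
    simp only [Equiv.symm_apply_apply] at h
    show blockOf L M (site L M b j + unitVec (fine L M) μ) = blockOf L M (site L M b j)
    rw [site_add_unitVec_of_lt L M μ b j h, blockOf_site, blockOf_site]
  dep_succ_of_lt := fun y h => by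
    obtain ⟨⟨b, j⟩, rfl⟩ := (blockEquiv L M).surjective y
    simp only [Equiv.symm_apply_apply] at h
    show ((((blockEquiv L M).symm (site L M b j + unitVec (fine L M) μ)).2 μ : Fin L) : ℕ) =
      ((((blockEquiv L M).symm (site L M b j)).2 μ : Fin L) : ℕ) + 1
    rw [site_add_unitVec_of_lt L M μ b j h, blockEquiv_symm_site, blockEquiv_symm_site]
    simp
  π_succ_of_eq := fun y h => by
    obtain ⟨⟨b, j⟩, rfl⟩ := (blockEquiv L M).surjective y
    simp only [Equiv.symm_apply_apply] at h
    show blockOf L M (site L M b j + unitVec (fine L M) μ) = blockOf L M (site L M b j) + unitVec M μ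
    rw [site_add_unitVec_of_eq L M μ b j h, blockOf_site, blockOf_site]
  dep_succ_of_eq := fun y h => by
    obtain ⟨⟨b, j⟩, rfl⟩ := (blockEquiv L M).surjective y
    simp only [Equiv.symm_apply_apply] at h
    show ((((blockEquiv L M).symm (site L M b j + unitVec (fine L M) μ)).2 μ : Fin L) : ℕ) = 0
    rw [site_add_unitVec_of_eq L M μ b j h, blockEquiv_symm_site]
    simp

/-- The block projection of King's line data IS `King1986.Torus.blockOf`. [folklore] -/
@[simp] theorem kingLine_π : (kingLine L M μ).π = blockOf L M := rfl

/-- Its spacing ratio is `L`. [folklore] -/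
@[simp] theorem kingLine_M : (kingLine L M μ).M = L := rfl

/-- Its coarse shift is the coarse torus translation by `e_μ`. [folklore] -/
@[simp] theorem kingLine_s (b : Tor M) : (kingLine L M μ).s b = b + unitVec M μ := rfl

/-- Its fine shift is the fine torus translation by `e_μ`. [folklore] -/
@[simp] theorem kingLine_s' (y : Tor (fine L M)) : (kingLine L M μ).s' y = y + unitVec (fine L M) μ := rfl

/-- Its depth at `L·b + j` is the offset `j_μ`. [folklore] -/
theorem kingLine_dep_site (b : Tor M) (j : Fin d → Fin L) : (kingLine L M μ).dep (site L M b j) = (j μ : ℕ) := by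
  show (((blockEquiv L M).symm (site L M b j)).2 μ : ℕ) = (j μ : ℕ)
  rw [blockEquiv_symm_site]

/-! ## §3 The η-defect of the lattice derivative on King's carrier, BY NAME -/

/-- **THE EXACT DEFECT FORMULA ON KING'S TORUS PAIR** (part 1's `idef_fdiffN_apply` at `kingLine`): for spacings `Lη′ = η`,
`𝔇(∇′_{η′,μ}, ∇_{η,μ})(f)(y) = χ(y)·η⁻¹·(f(⌊y∕L⌋ + e_μ) − f(⌊y∕L⌋))` with `χ = L·1_{j_μ = L−1} − 1` — order one pointwise; its smallness inside
composites is parts 2∕4 applied to `kingLine L M μ`. [folklore] -/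
theorem idef_fdiffN_king_apply {η η' : ℝ} (hη' : η' ≠ 0) (hLη : (L : ℝ) * η' = η) (f : Tor M → ℝ) (y : Tor (fine L M)) :
    T4EtaRateDefect.idef (T4EtaRateCoeffDefect.pull (blockOf L M)) (T4EtaRateCoeffDefect.pull (blockOf L M))
        (fdiffN η' (kingLine L M μ).s') (fdiffN η (kingLine L M μ).s) f y =
      (kingLine L M μ).chi y * (η⁻¹ * (f (blockOf L M y + unitVec M μ) - f (blockOf L M y))) :=
  idef_fdiffN_apply (kingLine L M μ) hη' hLη f y

end Summit.QuantumFields.YangMills.BalabanUVNodes.N15.KingTorusLine
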